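import Summits.QuantumFields.YangMills.Theorems.ForcedResponseSkewnessFemtoEngineClusterPin
import Summits.QuantumFields.YangMills.Theorems.ForcedResponseSkewnessResponseLocalisationFarOfClustering
import Summits.QuantumFields.YangMills.Theorems.BalabanLadderUVSeamRecCeilingsTransfer
import HarnessLib

/-!
# Route `ForcedResponseSkewness`: the residual's FAR-FIELD clause follows from the SAME engine-and-clustering item (lead `ym-line-frs-p1` g7, 2026-08-28)

Helper file (`--supports stmt-QuantumFields-26871`; also bears on the residual 24873).  The rev-4 «RESTATE-FAR» edit moved the far-field response
ceiling (`FarSigR`, Defs `…ResponseLocalisationDefs.lean`) out of the deciding crux into the declared residual, because it needs gap-class clustering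
(`Far.farSigR_of_fbl_clustering`: FBL ∧ torus clustering along every floor-pinned unit ⇒ `FarSigR`).  g7 showed that the two remaining cruxes, as typed
(«∀ floor-pinned unit»), ALREADY cost gap-class clustering in the engine's unit (`femtoEngineSigR_of_engine_clustering`).  This file closes the circle:
the ONE item «∀ (G, r) ∃ u: `FemtoEngineAt G r u` ∧ torus clustering in u» also yields `FarSigR` — so the far-field clause of the residual is
discharged by the same item and «RESTATE-FAR» can be undone at no extra cost in kind (owner's call).

* `clustering_of_unit` — torus clustering moves from `u` to any unit `a` with `a ≤ M·u` eventually (rate `m/M`, torus threshold `M·max(Λ₀,0)`);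
* `fbl_clustering_of_engine_clustering` — engine ∧ clustering in `u` ⇒ `FBL G r a` ∧ clustering in `a` for EVERY floor-pinned `a` (fine pin via
  `hyperscalingClustering_of_fbl_clustering` + `floorPinsFine_of_hyperscalingClustering` + the spine's `fbl_of_eventually_le`; coarse pin via
  `floorPins_coarse_of_femtoEngineAt`);
* **`farSigR_of_engine_clustering`** — the same item ⇒ `FarSigR` (frs-p2's `Far.farSigR_of_fbl_clustering`).

HONEST LABEL: bookkeeping on a conditional rung line (leaf R2a `BalabanLadder.NT`); the engine laws, the clustering (= the lattice gap in the unit u), `FarSigR`'s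
physics, the residual, the cruxes, NT and the Yang–Mills mass gap are NOT proved.
-/

set_option autoImplicit false

noncomputable section

namespace Summit.QuantumFields.YangMills.Cruxes.ResponseLocalisation.FemtoEngine

open scoped SchwartzMap
open MeasureTheory Filter Topology
open Literature.MathematicalPhysics.QuantumFieldTheory Literature.MathematicalPhysics.QuantumLattice
open Literature.Probability.LatticeModels
open Summit.QuantumFields.YangMills.Cruxes.OSLegsFromFemtoAndGap.DlrCollarTransfer
open Summit.QuantumFields.YangMills.Cruxes.ResponseLocalisation.Birth
open Summit.QuantumFields.YangMills.Cruxes.ResponseLocalisation.Far (farSigR_of_fbl_clustering)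
open Summit.QuantumFields.YangMills.Cruxes.UVSeamRec.CeilingsTransfer (fbl_of_eventually_le)
open Summit.QuantumFields.YangMills.Cruxes.NT.BoundaryLaw (fbl6_of_oscillation)

variable {G : Type} [Group G] [TopologicalSpace G] [IsTopologicalGroup G] [CompactSpace G]
  [MeasurableSpace G] [BorelSpace G] (r : LatticeRep G)

/-- **Torus clustering moves to any unit not finer than `u/M`**: rate `m/M`, torus threshold `M·max(Λ₀,0)`. [folklore] -/
theorem clustering_of_unit {a u : ℝ → ℝ} {M : ℝ} (hM : 0 < M) (hu : ∀ β, 0 < u β)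
    (hle : ∀ᶠ β in atTop, a β ≤ M * u β)
    (hCl : ∃ m K β₀ Λ₀ : ℝ, 0 < m ∧ 0 ≤ K ∧ ∀ β : ℝ, β₀ ≤ β → ∀ L : ℕ, Λ₀ ≤ u β * L →
      ∀ (P Q : LGConfig 4 G → ℝ) (SP SQ : Finset (Literature.MathematicalPhysics.QuantumLattice.ZdEdge 4))
        (CP CQ : ℝ), Continuous P → Continuous Q → IsCylinder P SP → IsCylinder Q SQ →
        (∀ U, |P U| ≤ CP) → (∀ U, |Q U| ≤ CQ) → ∀ (k : Fin 4) (n : ℕ),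
        (∀ e ∈ SP, ∀ e' ∈ SQ, (n : ℤ) ≤ |((((e.1 k - e'.1 k : ℤ) : ZMod (2 * L + 1))).valMinAbs : ℤ)|) →
        |torusE G r β L (fun U => P U * Q U) - torusE G r β L P * torusE G r β L Q| ≤
          K * CP * CQ * Real.exp (-(m * u β * n))) :
    ∃ m K β₀ Λ₀ : ℝ, 0 < m ∧ 0 ≤ K ∧ ∀ β : ℝ, β₀ ≤ β → ∀ L : ℕ, Λ₀ ≤ a β * L →
      ∀ (P Q : LGConfig 4 G → ℝ) (SP SQ : Finset (Literature.MathematicalPhysics.QuantumLattice.ZdEdge 4))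
        (CP CQ : ℝ), Continuous P → Continuous Q → IsCylinder P SP → IsCylinder Q SQ →
        (∀ U, |P U| ≤ CP) → (∀ U, |Q U| ≤ CQ) → ∀ (k : Fin 4) (n : ℕ),
        (∀ e ∈ SP, ∀ e' ∈ SQ, (n : ℤ) ≤ |((((e.1 k - e'.1 k : ℤ) : ZMod (2 * L + 1))).valMinAbs : ℤ)|) →
        |torusE G r β L (fun U => P U * Q U) - torusE G r β L P * torusE G r β L Q| ≤
          K * CP * CQ * Real.exp (-(m * a β * n)) := by
  obtain ⟨m, K, β₀, Λ₀, hm, hK, H⟩ := hCl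
  obtain ⟨β₁, hβ₁⟩ := Filter.eventually_atTop.1 hle
  refine ⟨m / M, K, max β₀ β₁, M * max Λ₀ 0, by positivity, hK,
    fun β hβ L hL P Q SP SQ CP CQ hP hQ hPS hQS hPb hQb k n hsep => ?_⟩
  have hβ₀ : β₀ ≤ β := (le_max_left _ _).trans hβ
  have haM : a β ≤ M * u β := hβ₁ β ((le_max_right _ _).trans hβ)
  have huβ := hu β
  have hL0 : (0 : ℝ) ≤ L := Nat.cast_nonneg L
  have hLu : Λ₀ ≤ u β * L := by
    have h1 : M * max Λ₀ 0 ≤ M * (u β * L) := by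
      calc M * max Λ₀ 0 ≤ a β * L := hL
        _ ≤ M * u β * L := mul_le_mul_of_nonneg_right haM hL0
        _ = M * (u β * L) := by ring
    have h2 : max Λ₀ 0 ≤ u β * L := le_of_mul_le_mul_left h1 hM
    exact (le_max_left _ _).trans h2
  have hcl := H β hβ₀ L hLu P Q SP SQ CP CQ hP hQ hPS hQS hPb hQb k n hsep
  have hCP : 0 ≤ CP := (abs_nonneg _).trans (hPb fun _ => 1)
  have hCQ : 0 ≤ CQ := (abs_nonneg _).trans (hQb fun _ => 1)
  have hexp : Real.exp (-(m * u β * n)) ≤ Real.exp (-(m / M * a β * n)) := by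
    apply Real.exp_le_exp.2
    have hn : (0 : ℝ) ≤ n := Nat.cast_nonneg n
    have h1 : m / M * a β ≤ m * u β := by
      rw [div_mul_eq_mul_div, div_le_iff₀ hM]
      calc m * a β ≤ m * (M * u β) := mul_le_mul_of_nonneg_left haM hm.le
        _ = m * u β * M := by ring
    nlinarith
  exact hcl.trans (mul_le_mul_of_nonneg_left hexp (by positivity))

omit [MeasurableSpace G] [BorelSpace G] in
/-- **Engine ∧ clustering in one unit give FBL ∧ clustering along EVERY floor-pinned unit** (the hypothesis of frs-p2's
`Far.farSigR_of_fbl_clustering`). [folklore] -/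
theorem fbl_clustering_of_engine_clustering
    (h : ∀ (G : Type) [Group G] [TopologicalSpace G] [IsTopologicalGroup G] [CompactSpace G],
      IsCompactSimpleLieGroup G →
      letI : MeasurableSpace G := borel G
      haveI : BorelSpace G := ⟨rfl⟩
      ∀ (r : LatticeRep G), ∃ u : ℝ → ℝ, (∀ β, 0 < u β) ∧ Filter.Tendsto u Filter.atTop (nhds 0) ∧
        FemtoEngineAt G r u ∧
        (∃ m K β₀ Λ₀ : ℝ, 0 < m ∧ 0 ≤ K ∧ ∀ β : ℝ, β₀ ≤ β → ∀ L : ℕ, Λ₀ ≤ u β * L →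
          ∀ (P Q : LGConfig 4 G → ℝ) (SP SQ : Finset (Literature.MathematicalPhysics.QuantumLattice.ZdEdge 4))
            (CP CQ : ℝ), Continuous P → Continuous Q → IsCylinder P SP → IsCylinder Q SQ →
            (∀ U, |P U| ≤ CP) → (∀ U, |Q U| ≤ CQ) → ∀ (k : Fin 4) (n : ℕ),
            (∀ e ∈ SP, ∀ e' ∈ SQ, (n : ℤ) ≤ |((((e.1 k - e'.1 k : ℤ) : ZMod (2 * L + 1))).valMinAbs : ℤ)|) →
            |torusE G r β L (fun U => P U * Q U) - torusE G r β L P * torusE G r β L Q| ≤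
              K * CP * CQ * Real.exp (-(m * u β * n)))) :
    ∀ (G : Type) [Group G] [TopologicalSpace G] [IsTopologicalGroup G] [CompactSpace G],
      IsCompactSimpleLieGroup G →
      letI : MeasurableSpace G := borel G
      haveI : BorelSpace G := ⟨rfl⟩
      ∀ (r : LatticeRep G) (a : ℝ → ℝ), (∀ β, 0 < a β) → Filter.Tendsto a Filter.atTop (nhds 0) →
        (∃ (v₀ : 𝓢(EuclideanSpace ℝ (Fin 4), ℝ)) (ε β₅ Λ₅ : ℝ), HasCompactSupport v₀ ∧
          tsupport v₀ ⊆ {y : EuclideanSpace ℝ (Fin 4) | 0 < y 0} ∧ 0 < ε ∧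
          ∀ β : ℝ, β₅ ≤ β → ∀ L : ℕ, Λ₅ ≤ a β * L → ε ≤ Q2 G r β L (a β) (thetaTest 4 v₀) v₀) →
        FBL G r a ∧
        (∃ m K β₀ Λ₀ : ℝ, 0 < m ∧ 0 ≤ K ∧ ∀ β : ℝ, β₀ ≤ β → ∀ L : ℕ, Λ₀ ≤ a β * L →
          ∀ (P Q : LGConfig 4 G → ℝ) (SP SQ : Finset (Literature.MathematicalPhysics.QuantumLattice.ZdEdge 4))
            (CP CQ : ℝ), Continuous P → Continuous Q → IsCylinder P SP → IsCylinder Q SQ →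
            (∀ U, |P U| ≤ CP) → (∀ U, |Q U| ≤ CQ) → ∀ (k : Fin 4) (n : ℕ),
            (∀ e ∈ SP, ∀ e' ∈ SQ, (n : ℤ) ≤ |((((e.1 k - e'.1 k : ℤ) : ZMod (2 * L + 1))).valMinAbs : ℤ)|) →
            |torusE G r β L (fun U => P U * Q U) - torusE G r β L P * torusE G r β L Q| ≤
              K * CP * CQ * Real.exp (-(m * a β * n))) := by
  intro G _ _ _ _ hG
  letI : MeasurableSpace G := borel G
  haveI : BorelSpace G := ⟨rfl⟩
  intro r a ha ha0 hpin
  obtain ⟨u, hu, hu0, hE, hCl⟩ := h G hG r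
  -- FBL in the engine unit
  obtain ⟨D, C₁, β₁, ℓ₁, hℓ₁, H⟩ := hE.1
  have hFu : FBL G r u := fbl_of_fbl6 r u (fbl6_of_oscillation G r u hu D ⟨C₁, β₁, ℓ₁, hℓ₁, H⟩)
  -- the two pins
  have hHC : HyperscalingClustering G r u := hyperscalingClustering_of_fbl_clustering G r hu hu0 hFu hCl
  obtain ⟨C, hfine⟩ := floorPinsFine_of_hyperscalingClustering r hu hHC a ha ha0 hpin
  obtain ⟨M, hM, hcoarse⟩ := floorPins_coarse_of_femtoEngineAt r hu hu0 hE ha ha0 hpin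
  have hfine' : ∀ᶠ β in atTop, u β ≤ max C 1 * a β :=
    hfine.mono fun β hβ => hβ.trans (mul_le_mul_of_nonneg_right (le_max_left _ _) (ha β).le)
  refine ⟨fbl_of_eventually_le r (lt_of_lt_of_le one_pos (le_max_right C 1)) hfine' hFu, ?_⟩
  exact clustering_of_unit r hM hu hcoarse hCl

omit [MeasurableSpace G] [BorelSpace G] in
/-- **The far-field response ceiling from the engine-and-clustering item**: `FarSigR` (the body of the residual's rev-4 far-field clause along every
floor-pinned unit) follows from «∀ (G, r) ∃ u: `FemtoEngineAt G r u` ∧ torus clustering in u».  Nothing of the hypotheses is proved. [folklore] -/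
theorem farSigR_of_engine_clustering
    (h : ∀ (G : Type) [Group G] [TopologicalSpace G] [IsTopologicalGroup G] [CompactSpace G],
      IsCompactSimpleLieGroup G →
      letI : MeasurableSpace G := borel G
      haveI : BorelSpace G := ⟨rfl⟩
      ∀ (r : LatticeRep G), ∃ u : ℝ → ℝ, (∀ β, 0 < u β) ∧ Filter.Tendsto u Filter.atTop (nhds 0) ∧
        FemtoEngineAt G r u ∧
        (∃ m K β₀ Λ₀ : ℝ, 0 < m ∧ 0 ≤ K ∧ ∀ β : ℝ, β₀ ≤ β → ∀ L : ℕ, Λ₀ ≤ u β * L →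
          ∀ (P Q : LGConfig 4 G → ℝ) (SP SQ : Finset (Literature.MathematicalPhysics.QuantumLattice.ZdEdge 4))
            (CP CQ : ℝ), Continuous P → Continuous Q → IsCylinder P SP → IsCylinder Q SQ →
            (∀ U, |P U| ≤ CP) → (∀ U, |Q U| ≤ CQ) → ∀ (k : Fin 4) (n : ℕ),
            (∀ e ∈ SP, ∀ e' ∈ SQ, (n : ℤ) ≤ |((((e.1 k - e'.1 k : ℤ) : ZMod (2 * L + 1))).valMinAbs : ℤ)|) →
            |torusE G r β L (fun U => P U * Q U) - torusE G r β L P * torusE G r β L Q| ≤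
              K * CP * CQ * Real.exp (-(m * u β * n)))) :
    FarSigR :=
  farSigR_of_fbl_clustering (fbl_clustering_of_engine_clustering h)

end Summit.QuantumFields.YangMills.Cruxes.ResponseLocalisation.FemtoEngine

end
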